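import Literature.NumberTheory.DiophantineGeometry.AbcWave0QualityFormProofs
import Literature.NumberTheory.DiophantineGeometry.AbcWeakFermatProofs
import HarnessLib

/-!
# Baker's explicit abc conjecture (abc.S04): what it implies — proved consequences

`Literature.NumberTheory.DiophantineGeometry.BakerExplicitABC` (abc.S04 in
`Literature.NumberTheory.DiophantineGeometry.AbcWave0`) is **Baker's Conjecture 4**:
"Conjecture 4. We have `max(|a|, |b|, |c|) < (6/5) N (log N)^ω/ω!`" for integers `a + b + c = 0` with
no common factor, `N` the radical of `abc` and `ω = ω(abc)` [cite: Baker2004, §3 Conjecture 4 (p. 257);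
setup §1 (p. 253) and §2 (p. 255)]. It is an OPEN conjecture — "I would also be most interested if
anyone were able to compute a counter-example to Conjecture 4" [cite: Baker2004, §4 (p. 258)];
Laishram–Shorey work *assuming* it ("Assume Conjecture 1.2") [cite: LaishramShorey2012, Theorem 1] —
and it is STRONGER than the abc conjecture of Masser–Oesterlé (`BakerExplicitABC.abcQualityForm`
below), so there is no `BakerExplicitABC_holds`: the named fact can only be used as a hypothesis
`(h : BakerExplicitABC)`. This companion file proves, sorry-free and without touching any statement
of `AbcWave0`, the consequences that Baker and Laishram–Shorey print:

* `log_pow_div_factorial_le` — "certainly we have `(log N)^ω/ω! ≤ N`" [cite: Baker2004, §3 (p. 257)]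
  (one term of the exponential series, Mathlib's `Real.pow_div_factorial_le_exp`), and the sharper
  elementary bound `log_pow_div_factorial_le_div_exp` : `(log N)^ω/ω! ≤ N/e` for `ω ≥ 1`
  (from `k^k ≤ k! e^{k-1}`, `pow_self_le_factorial_mul_exp`);
* `BakerExplicitABC.lt_six_fifths_mul_rad_sq` — Conjecture 4 gives `c < (6/5) N²`
  ("Conjecture 4 implies that `zⁿ < (6/5)(xyz)² ≤ (6/5) z⁶`") [cite: Baker2004, §3 (p. 257)];
* `BakerExplicitABC.weakABCConjecture` — Conjecture 4 implies the Granville–Tucker explicit conjecture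
  `c < rad(abc)²` (`WeakABCConjecture`, abc.S03): "Thus `c < N²` which was conjectured in Granville and
  Tucker" [cite: LaishramShorey2012, Theorem 1 (arXiv p. 2)] (Laishram–Shorey deduce it from their sharper
  `c < N^{7/4}`, whose proof uses explicit prime-counting estimates; here `c < (6/(5e)) N² < N²`
  suffices);
* `BakerExplicitABC.fermatLastTheoremFor` — hence Fermat's Last Theorem for every exponent `n ≥ 6`
  ("Note that Conjecture 4 gives immediately a proof of Fermat's Last Theorem")
  [cite: Baker2004, §3 (p. 257)], via the already discharged abc.S12 record
  `weakABCConjecture_imp_fermatLastTheoremFor_holds`;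
* `BakerExplicitABC.forall_exists_const`, `BakerExplicitABC.abcQualityForm`,
  `BakerExplicitABC.not_abcNegation` — Conjecture 4 implies the abc conjecture with an explicit
  `C(ε)` ("Conjecture 4 … enables one to give an explicit expression for the implied constant
  depending on `ε` in the basic Oesterlé–Masser conjecture" [cite: Baker2004, §3 (pp. 257–258)];
  quantitatively [cite: LaishramShorey2012, Theorem 1]): for every `ε > 0` there is `C` with
  `(log N)^{ω}/ω! ≤ C N^ε` whenever `ω! ≤ N` (`exists_const_log_pow_div_factorial_le`), and
  `ω(abc)! ≤ rad(abc)` because the radical is a product of `ω(abc)` distinct primes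
  (`factorial_cardDistinctFactors_le_radical`). Inside `Literature/` the abc conjecture is
  `ABCQualityForm` / `¬ ABCNegation` (`abcQualityForm_iff_forall_exists_const`,
  `abcQualityForm_iff_not_abcNegation` of `AbcWave0QualityFormProofs`; the summit statement `ABC`
  itself is not importable here).
* `not_bakerExplicitBound_all_triples`, `bakerExplicitABC_iff_ne_one_one_two` (appended by the
  second provefact seat) — the binder `a < b` of abc.S04 is necessary and costs nothing else: over
  all abc triples Baker's inequality fails at `1 + 1 = 2` (`N = 2`, `ω = 1`,
  `(6/5) · 2 · log 2 = 1.66… < 2`), and `BakerExplicitABC` is equivalent to the inequality for every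
  abc triple other than `(1, 1, 2)`.

## The elementary estimate behind `Baker ⟹ abc` (proof of `exists_const_log_pow_div_factorial_le`)

Fix `ε > 0`, put `ε' = min ε 1`, `η = ε'/3`, `W = ⌈exp(1 + 1/η²)⌉`. Let `x ≥ 1`, `L = log x`, `k! ≤ x`.
If `k < W`: either `L ≤ 1` and `L^k/k! ≤ 1 ≤ x^ε`, or `L > 1` and
`L^k/k! ≤ L^W ≤ (x^{ε/W} W/ε)^W = (W/ε)^W x^ε` (`log x ≤ x^s/s`). If `k ≥ W`: `k^k/k! ≤ e^k` gives
`k log k - k ≤ log k! ≤ L`, and `log k ≥ 1 + 1/η²`, so `k ≤ η² L`; then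
`L^k/k! ≤ (L/k)^k e^k = exp(k log(L/k) + k) ≤ exp(ηL - k log η)` (as `log u ≤ ηu - log η - 1`), and
`-k log η ≤ k(1/η - 1) ≤ k/η ≤ ηL`, so `L^k/k! ≤ exp(2ηL) ≤ x^ε`. Hence `C(ε) = max(1, (W/ε)^W)`.
-/

noncomputable section

open UniqueFactorizationMonoid Real
open scoped ArithmeticFunction.omega Nat

namespace Literature.NumberTheory.DiophantineGeometry

/-! ### Elementary inequalities for `(log N)^ω / ω!` -/

/-- "Certainly we have `(log N)^ω/ω! ≤ N`" (one term of `exp(log N) = Σ (log N)^j/j!`), for real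
`N ≥ 1` and every `ω`. [cite: Baker2004, §3 (p. 257)] -/
theorem log_pow_div_factorial_le {x : ℝ} (hx : 1 ≤ x) (k : ℕ) :
    Real.log x ^ k / k ! ≤ x := by
  have h := Real.pow_div_factorial_le_exp _ (Real.log_nonneg hx) k
  rwa [Real.exp_log (by linarith)] at h

/-- `k^k ≤ k! · e^{k-1}` for `k ≥ 1` (induction: `(1 + 1/k)^k ≤ e`). [folklore] -/
theorem pow_self_le_factorial_mul_exp {k : ℕ} (hk : 1 ≤ k) :
    (k : ℝ) ^ k ≤ k ! * Real.exp (k - 1) := by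
  induction k, hk using Nat.le_induction with
  | base => simp
  | succ n hn ih =>
    have hn0 : (0 : ℝ) < n := by exact_mod_cast hn
    have h1 : ((n : ℝ) + 1) ^ n ≤ (n : ℝ) ^ n * Real.exp 1 := by
      have hexp : 1 + 1 / (n : ℝ) ≤ Real.exp (1 / n) := by
        have := Real.add_one_le_exp (1 / (n : ℝ)); linarith
      have h2 : (1 + 1 / (n : ℝ)) ^ n ≤ Real.exp (1 / n) ^ n :=
        pow_le_pow_left₀ (by positivity) hexp n
      rw [← Real.exp_nat_mul, mul_one_div_cancel hn0.ne'] at h2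
      have h3 : ((n : ℝ) + 1) ^ n = (n : ℝ) ^ n * (1 + 1 / (n : ℝ)) ^ n := by
        rw [← mul_pow]; congr 1; field_simp
      rw [h3]
      exact mul_le_mul_of_nonneg_left h2 (by positivity)
    push_cast [Nat.factorial_succ]
    calc ((n : ℝ) + 1) ^ (n + 1) = ((n : ℝ) + 1) * ((n : ℝ) + 1) ^ n := by ring
      _ ≤ ((n : ℝ) + 1) * ((n : ℝ) ^ n * Real.exp 1) := by gcongr
      _ ≤ ((n : ℝ) + 1) * ((n ! : ℝ) * Real.exp ((n : ℝ) - 1) * Real.exp 1) := by gcongr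
      _ = ((n : ℝ) + 1) * n ! * Real.exp ((n : ℝ) + 1 - 1) := by
          rw [show (n : ℝ) + 1 - 1 = ((n : ℝ) - 1) + 1 by ring, Real.exp_add]; ring

/-- `x^k/k! ≤ e^{x-1}` for `x ≥ 0` and `k ≥ 1` (`x/k ≤ e^{x/k - 1}` and `k^k ≤ k! e^{k-1}`).
[folklore] -/
theorem pow_div_factorial_le_exp_sub_one {x : ℝ} (hx : 0 ≤ x) {k : ℕ} (hk : 1 ≤ k) :
    x ^ k / k ! ≤ Real.exp (x - 1) := by
  have hk0 : (0 : ℝ) < k := by exact_mod_cast hk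
  have hfac : (0 : ℝ) < k ! := by positivity
  have h1 : x / k ≤ Real.exp (x / k - 1) := by
    have := Real.add_one_le_exp (x / k - 1); linarith
  have h2 : (x / k) ^ k ≤ Real.exp (x - k) := by
    have h := pow_le_pow_left₀ (by positivity) h1 k
    rwa [← Real.exp_nat_mul, show (k : ℝ) * (x / k - 1) = x - k by field_simp] at h
  have h3 : x ^ k ≤ (k : ℝ) ^ k * Real.exp (x - k) := by
    rw [div_pow, div_le_iff₀ (by positivity)] at h2
    linarith
  have h4 := pow_self_le_factorial_mul_exp hk
  rw [div_le_iff₀ hfac]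
  calc x ^ k ≤ (k : ℝ) ^ k * Real.exp (x - k) := h3
    _ ≤ ((k ! : ℝ) * Real.exp ((k : ℝ) - 1)) * Real.exp (x - k) := by gcongr
    _ = Real.exp (x - 1) * k ! := by
        rw [mul_assoc, ← Real.exp_add, show (k : ℝ) - 1 + (x - k) = x - 1 by ring, mul_comm]

/-- The sharper elementary bound `(log N)^ω/ω! ≤ N/e` for real `N ≥ 1` and `ω ≥ 1`. [folklore] -/
theorem log_pow_div_factorial_le_div_exp {x : ℝ} (hx : 1 ≤ x) {k : ℕ} (hk : 1 ≤ k) :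
    Real.log x ^ k / k ! ≤ x / Real.exp 1 := by
  have h := pow_div_factorial_le_exp_sub_one (Real.log_nonneg hx) hk
  rwa [Real.exp_sub, Real.exp_log (by linarith)] at h

/-! ### abc triples: symmetry and the degenerate triple `1 + 1 = 2` -/

variable {a b c : ℕ}

/-- abc triples are symmetric in `a, b` (local copy of `IsABCTriple.swap` of
`PastenSubexpTheorem14`, not imported here to keep this file light). [folklore] -/
private theorem IsABCTriple.symm (h : IsABCTriple a b c) : IsABCTriple b a c := by
  obtain ⟨ha, hb, habc, hcop⟩ := h
  exact ⟨hb, ha, by omega, hcop.symm⟩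

/-- The radical glue is symmetric in `a, b` (local copy of `rad_swap` of `PastenSubexpTheorem14`).
[folklore] -/
private theorem rad_swap' (a b c : ℕ) : rad b a c = rad a b c := by
  rw [rad_def, rad_def, mul_comm b a]

/-- The only abc triple with `a = b` is `1 + 1 = 2` (coprimality). [folklore] -/
theorem IsABCTriple.eq_one_of_eq (h : IsABCTriple a b c) (hab : a = b) :
    a = 1 ∧ b = 1 ∧ c = 2 := by
  obtain ⟨ha, hb, habc, hcop⟩ := h
  subst hab
  have ha1 : a = 1 := (Nat.coprime_self a).mp hcop
  subst ha1
  omega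

/-- `rad(1 · 1 · 2) = 2`. [folklore] -/
theorem rad_one_one_two : rad 1 1 2 = 2 := by
  rw [rad_def, show (1 * 1 * 2 : ℕ) = 2 from rfl,
    radical_of_prime (Nat.prime_iff.mp Nat.prime_two), normalize_eq]

/-- For an abc triple, `abc ≥ 2`, so `ω(abc) ≥ 1`. [folklore] -/
theorem IsABCTriple.one_le_cardDistinctFactors (h : IsABCTriple a b c) : 1 ≤ ω (a * b * c) := by
  rw [Nat.one_le_iff_ne_zero, Ne, ArithmeticFunction.cardDistinctFactors_eq_zero, not_le]
  obtain ⟨ha, hb, habc, -⟩ := h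
  calc 1 < c := by omega
    _ ≤ a * b * c := Nat.le_mul_of_pos_left c (Nat.mul_pos ha hb)

/-! ### Conjecture 4 ⟹ `c < (6/5) N²` ⟹ `c < N²` (weak abc) ⟹ FLT for `n ≥ 6` -/

/-- Baker: Conjecture 4 gives `c < (6/5) N²` for every abc triple with `a < b`, since
`(log N)^ω/ω! ≤ N` ("Conjecture 4 implies that `zⁿ < (6/5)(xyz)²`"). [cite: Baker2004, §3 (p. 257)] -/
theorem BakerExplicitABC.lt_six_fifths_mul_rad_sq (h : BakerExplicitABC) (ht : IsABCTriple a b c)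
    (hab : a < b) : (c : ℝ) < 6 / 5 * (rad a b c : ℝ) ^ 2 := by
  have hB : (c : ℝ) < 6 / 5 * (rad a b c : ℝ) *
      (Real.log (rad a b c : ℕ) ^ ω (a * b * c) / (ω (a * b * c))!) := by
    have := h a b c ht hab; rwa [mul_div_assoc] at this
  have hr1 : (1 : ℝ) ≤ (rad a b c : ℝ) := by
    exact_mod_cast le_trans (by norm_num) ht.two_le_rad
  have hle := log_pow_div_factorial_le hr1 (ω (a * b * c))
  calc (c : ℝ) < 6 / 5 * (rad a b c : ℝ) *
        (Real.log (rad a b c : ℕ) ^ ω (a * b * c) / (ω (a * b * c))!) := hB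
    _ ≤ 6 / 5 * (rad a b c : ℝ) * (rad a b c : ℝ) := by gcongr
    _ = 6 / 5 * (rad a b c : ℝ) ^ 2 := by ring

/-- Conjecture 4 gives `c < rad(abc)²` for every abc triple with `a < b`: by
`(log N)^ω/ω! ≤ N/e` (`ω ≥ 1`), `c < (6/(5e)) N² < N²`. [cite: LaishramShorey2012, Theorem 1 (arXiv p. 2)] -/
theorem BakerExplicitABC.lt_rad_sq (h : BakerExplicitABC) (ht : IsABCTriple a b c) (hab : a < b) :
    c < rad a b c ^ 2 := by
  have hB : (c : ℝ) < 6 / 5 * (rad a b c : ℝ) *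
      (Real.log (rad a b c : ℕ) ^ ω (a * b * c) / (ω (a * b * c))!) := by
    have := h a b c ht hab; rwa [mul_div_assoc] at this
  have hr1 : (1 : ℝ) ≤ (rad a b c : ℝ) := by
    exact_mod_cast le_trans (by norm_num) ht.two_le_rad
  have hle := log_pow_div_factorial_le_div_exp hr1 ht.one_le_cardDistinctFactors
  have he : 6 / 5 / Real.exp 1 ≤ (1 : ℝ) := by
    rw [div_le_one (Real.exp_pos 1)]
    linarith [Real.add_one_le_exp (1 : ℝ)]
  have hreal : (c : ℝ) < (rad a b c : ℝ) ^ 2 := by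
    calc (c : ℝ) < 6 / 5 * (rad a b c : ℝ) *
          (Real.log (rad a b c : ℕ) ^ ω (a * b * c) / (ω (a * b * c))!) := hB
      _ ≤ 6 / 5 * (rad a b c : ℝ) * ((rad a b c : ℝ) / Real.exp 1) := by gcongr
      _ = 6 / 5 / Real.exp 1 * (rad a b c : ℝ) ^ 2 := by ring
      _ ≤ 1 * (rad a b c : ℝ) ^ 2 := by gcongr
      _ = (rad a b c : ℝ) ^ 2 := one_mul _
  exact_mod_cast hreal

/-- **Baker's Conjecture 4 implies the Granville–Tucker explicit conjecture `c < rad(abc)²`**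
(`WeakABCConjecture`, abc.S03): "Thus `c < N²` which was conjectured in Granville and Tucker".
The normalisation `a < b` of `BakerExplicitABC` is removed by symmetry; the excluded triple
`1 + 1 = 2` has `2 < rad² = 4`. [cite: LaishramShorey2012, Theorem 1 (arXiv p. 2)] -/
theorem BakerExplicitABC.weakABCConjecture (h : BakerExplicitABC) : WeakABCConjecture := by
  intro a b c ht
  rcases lt_trichotomy a b with hab | hab | hab
  · exact h.lt_rad_sq ht hab
  · obtain ⟨rfl, rfl, rfl⟩ := ht.eq_one_of_eq hab
    rw [rad_one_one_two]; norm_num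
  · have := h.lt_rad_sq ht.symm hab
    rwa [rad_swap'] at this

/-- **Baker's Conjecture 4 implies Fermat's Last Theorem for every exponent `n ≥ 6`** ("Note that
Conjecture 4 gives immediately a proof of Fermat's Last Theorem. For certainly we have
`(log N)^ω/ω! ≤ N` and so if `xⁿ + yⁿ = zⁿ` then Conjecture 4 implies that `zⁿ < (6/5)(xyz)² ≤ (6/5) z⁶`"),
here through `c < rad(abc)²` and the discharged abc.S12 record. [cite: Baker2004, §3 (p. 257)] -/
theorem BakerExplicitABC.fermatLastTheoremFor (h : BakerExplicitABC) {n : ℕ} (hn : 6 ≤ n) :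
    FermatLastTheoremFor n :=
  weakABCConjecture_imp_fermatLastTheoremFor_holds h.weakABCConjecture hn

/-! ### Conjecture 4 ⟹ the abc conjecture (quality form / `C(ε)` form) -/

/-- A finite set of `n` positive integers has product `≥ n!`. [folklore] -/
theorem card_factorial_le_prod (S : Finset ℕ) :
    (∀ s ∈ S, 1 ≤ s) → (S.card)! ≤ ∏ s ∈ S, s := by
  induction S using Finset.induction_on_max with
  | empty => simp
  | insert m S hlt ih =>
    intro hS
    have hmS : m ∉ S := fun hm => lt_irrefl _ (hlt m hm)
    have hS' : ∀ s ∈ S, 1 ≤ s := fun s hs => hS s (Finset.mem_insert_of_mem hs)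
    have hcard : S.card + 1 ≤ m := by
      have hsub : S ⊆ Finset.Ico 1 m := fun s hs => Finset.mem_Ico.mpr ⟨hS' s hs, hlt s hs⟩
      have h1 := Finset.card_le_card hsub
      rw [Nat.card_Ico] at h1
      have hm1 : 1 ≤ m := hS m (Finset.mem_insert_self m S)
      omega
    rw [Finset.card_insert_of_notMem hmS, Finset.prod_insert hmS, Nat.factorial_succ]
    exact Nat.mul_le_mul hcard (ih hS')

/-- `ω(n) = #primeFactors(n)`. [folklore] -/
theorem cardDistinctFactors_eq_card_primeFactors (n : ℕ) : ω n = n.primeFactors.card := by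
  rw [ArithmeticFunction.cardDistinctFactors_apply, ← List.card_toFinset]; rfl

/-- `ω(n)! ≤ rad(n)`: the radical (in `ℕ`) is the product of the `ω(n)` distinct primes dividing
`n`. [folklore] -/
theorem factorial_cardDistinctFactors_le_radical (n : ℕ) : (ω n)! ≤ radical n := by
  rw [cardDistinctFactors_eq_card_primeFactors, Nat.radical_eq_prod_primeFactors]
  exact card_factorial_le_prod _ fun p hp => (Nat.prime_of_mem_primeFactors hp).one_le

/-- **The estimate behind "Conjecture 4 ⟹ abc with an explicit `C(ε)`"**: for every `ε > 0` there is
`C ≥ 1` such that `(log x)^k/k! ≤ C x^ε` for all real `x ≥ 1` and all `k` with `k! ≤ x` (so for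
`x = N = rad(abc)`, `k = ω(abc)`); here `C = max(1, (W/ε)^W)` with `W = ⌈exp(1 + 9/min(ε,1)²)⌉`
(see the module docstring for the two-case argument). [cite: Baker2004, §3 (pp. 257–258)] -/
theorem exists_const_log_pow_div_factorial_le (ε : ℝ) (hε : 0 < ε) :
    ∃ C : ℝ, 1 ≤ C ∧ ∀ (k : ℕ) (x : ℝ), 1 ≤ x → ((k ! : ℕ) : ℝ) ≤ x →
      Real.log x ^ k / k ! ≤ C * x ^ ε := by
  -- parameters
  set ε' : ℝ := min ε 1 with hε'
  have hε'pos : 0 < ε' := lt_min hε one_pos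
  have hε'le : ε' ≤ ε := min_le_left _ _
  have hε'le1 : ε' ≤ 1 := min_le_right _ _
  set η : ℝ := ε' / 3 with hη
  have hηpos : 0 < η := by positivity
  set W : ℕ := ⌈Real.exp (1 + 1 / η ^ 2)⌉₊ with hW
  have hW1 : 1 ≤ W := Nat.ceil_pos.mpr (Real.exp_pos _)
  have hW0 : (0 : ℝ) < W := by exact_mod_cast hW1
  refine ⟨max 1 (((W : ℝ) / ε) ^ W), le_max_left _ _, fun k x hx hkx => ?_⟩
  have hx0 : 0 < x := by linarith
  have hL0 : 0 ≤ Real.log x := Real.log_nonneg hx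
  have hxε : 1 ≤ x ^ ε := Real.one_le_rpow hx hε.le
  have hxε0 : 0 ≤ x ^ ε := by positivity
  have hkfac : (0 : ℝ) < k ! := by positivity
  have hkfac1 : (1 : ℝ) ≤ k ! := by exact_mod_cast Nat.one_le_of_lt (Nat.factorial_pos k)
  have hC1 : (1 : ℝ) ≤ max 1 (((W : ℝ) / ε) ^ W) := le_max_left _ _
  have hdiv : Real.log x ^ k / k ! ≤ Real.log x ^ k := div_le_self (pow_nonneg hL0 k) hkfac1
  rcases lt_or_ge k W with hkW | hkW
  · -- few prime factors: `k < W`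
    rcases le_or_gt (Real.log x) 1 with hL1 | hL1
    · calc Real.log x ^ k / k ! ≤ Real.log x ^ k := hdiv
        _ ≤ 1 := pow_le_one₀ hL0 hL1
        _ ≤ max 1 (((W : ℝ) / ε) ^ W) * x ^ ε := one_le_mul_of_one_le_of_one_le hC1 hxε
    · have h1 : Real.log x ^ k ≤ Real.log x ^ W := pow_le_pow_right₀ hL1.le hkW.le
      have h2 : Real.log x ≤ x ^ (ε / W) / (ε / W) := Real.log_le_rpow_div hx0.le (by positivity)
      have h3 : Real.log x ^ W ≤ (x ^ (ε / W) / (ε / W)) ^ W := pow_le_pow_left₀ hL0 h2 W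
      have h4 : (x ^ (ε / W) / (ε / W)) ^ W = ((W : ℝ) / ε) ^ W * x ^ ε := by
        rw [div_pow, ← Real.rpow_mul_natCast hx0.le, div_mul_cancel₀ ε hW0.ne', div_eq_mul_inv,
          ← inv_pow, inv_div, mul_comm]
      calc Real.log x ^ k / k ! ≤ Real.log x ^ k := hdiv
        _ ≤ ((W : ℝ) / ε) ^ W * x ^ ε := by rw [← h4]; exact h1.trans h3
        _ ≤ max 1 (((W : ℝ) / ε) ^ W) * x ^ ε :=
          mul_le_mul_of_nonneg_right (le_max_right _ _) hxε0
  · -- many prime factors: `W ≤ k`, so `k ≥ 1`, `log k ≥ 1 + 1/η²`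
    have hk1 : 1 ≤ k := hW1.trans hkW
    have hk0 : (0 : ℝ) < k := by exact_mod_cast hk1
    have hlogk : 1 + 1 / η ^ 2 ≤ Real.log k := by
      rw [Real.le_log_iff_exp_le hk0]
      calc Real.exp (1 + 1 / η ^ 2) ≤ W := Nat.le_ceil _
        _ ≤ k := by exact_mod_cast hkW
    -- `k log k - k ≤ log k! ≤ log x`
    have hfac_exp : (k : ℝ) ^ k / k ! ≤ Real.exp k := Real.pow_div_factorial_le_exp _ hk0.le k
    set L := Real.log x with hLdef
    have hlogfac : k * Real.log k - k ≤ L := by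
      have h1 : (k : ℝ) ^ k ≤ Real.exp k * k ! := by rwa [div_le_iff₀ hkfac] at hfac_exp
      have h2 : Real.log ((k : ℝ) ^ k) ≤ Real.log (Real.exp k * k !) :=
        Real.log_le_log (by positivity) h1
      rw [Real.log_pow, Real.log_mul (Real.exp_pos _).ne' hkfac.ne', Real.log_exp] at h2
      have h3 : Real.log (k ! : ℝ) ≤ L := Real.log_le_log hkfac hkx
      linarith
    -- hence `k ≤ η² L` and `L > 0`
    have hkL : (k : ℝ) ≤ η ^ 2 * L := by
      have h1 : (k : ℝ) * (1 + 1 / η ^ 2) ≤ k * Real.log k :=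
        mul_le_mul_of_nonneg_left hlogk hk0.le
      have h2 : (k : ℝ) / η ^ 2 ≤ L := by
        have : (k : ℝ) * (1 + 1 / η ^ 2) = k + k / η ^ 2 := by ring
        linarith
      have h3 := (div_le_iff₀ (show (0 : ℝ) < η ^ 2 by positivity)).mp h2
      linarith
    have hη2 : (0 : ℝ) < η ^ 2 := by positivity
    have hLpos : 0 < L := by
      have h1 : (1 : ℝ) ≤ η ^ 2 * L := le_trans (by exact_mod_cast hk1) hkL
      exact pos_of_mul_pos_right (lt_of_lt_of_le one_pos h1) hη2.le
    -- `L^k/k! ≤ (L/k)^k e^k`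
    have hstep1 : L ^ k / k ! ≤ (L / k) ^ k * Real.exp k := by
      have : L ^ k / k ! = (L / k) ^ k * ((k : ℝ) ^ k / k !) := by
        rw [div_pow]; field_simp
      rw [this]
      exact mul_le_mul_of_nonneg_left hfac_exp (by positivity)
    -- `log (L/k) ≤ η (L/k) - log η - 1`
    have hstep2 : Real.log (L / k) ≤ η * (L / k) - Real.log η - 1 := by
      have h := Real.log_le_sub_one_of_pos (show 0 < η * (L / k) by positivity)
      rw [Real.log_mul hηpos.ne' (by positivity)] at h
      linarith
    -- `(L/k)^k ≤ exp (η L - k log η - k)`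
    have hstep3 : (L / k) ^ k ≤ Real.exp (η * L - k * Real.log η - k) := by
      have h1 : L / k ≤ Real.exp (η * (L / k) - Real.log η - 1) := by
        calc L / k = Real.exp (Real.log (L / k)) := (Real.exp_log (by positivity)).symm
          _ ≤ Real.exp (η * (L / k) - Real.log η - 1) := Real.exp_le_exp.mpr hstep2
      calc (L / k) ^ k ≤ Real.exp (η * (L / k) - Real.log η - 1) ^ k :=
            pow_le_pow_left₀ (by positivity) h1 k
        _ = Real.exp (η * L - k * Real.log η - k) := by
            rw [← Real.exp_nat_mul]
            congr 1
            field_simp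
    -- `-k log η ≤ k (1/η - 1) ≤ k/η ≤ η L`
    have hstep4 : -(k * Real.log η) ≤ η * L := by
      have h1 : Real.log η⁻¹ ≤ η⁻¹ - 1 := Real.log_le_sub_one_of_pos (inv_pos.mpr hηpos)
      rw [Real.log_inv] at h1
      have hηinv : (0 : ℝ) ≤ η⁻¹ := (inv_pos.mpr hηpos).le
      have h2 : -((k : ℝ) * Real.log η) ≤ k * η⁻¹ := by nlinarith
      calc -((k : ℝ) * Real.log η) ≤ k * η⁻¹ := h2
        _ ≤ η ^ 2 * L * η⁻¹ := mul_le_mul_of_nonneg_right hkL hηinv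
        _ = η * L := by field_simp
    have h2η : 2 * η ≤ ε := by rw [hη]; linarith
    have hexp : η * L - k * Real.log η ≤ ε * L := by
      have := mul_le_mul_of_nonneg_right h2η hLpos.le
      linarith
    calc L ^ k / k ! ≤ (L / k) ^ k * Real.exp k := hstep1
      _ ≤ Real.exp (η * L - k * Real.log η - k) * Real.exp k := by gcongr
      _ = Real.exp (η * L - k * Real.log η) := by
          rw [← Real.exp_add]; congr 1; ring
      _ ≤ Real.exp (ε * L) := Real.exp_le_exp.mpr hexp
      _ = x ^ ε := by rw [Real.rpow_def_of_pos hx0, mul_comm]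
      _ ≤ max 1 (((W : ℝ) / ε) ^ W) * x ^ ε := le_mul_of_one_le_left hxε0 hC1

/-- **Conjecture 4 implies the abc conjecture in its `C(ε)` form** (Bombieri–Gubler Conj. 12.2.2; the
sentence of the summit statement `ABC`), with the explicit constant `C(ε) = (6/5) · max(1, (W/ε)^W)`
of `exists_const_log_pow_div_factorial_le`: "Conjecture 4 … enables one to give an explicit
expression for the implied constant depending on `ε` in the basic Oesterlé–Masser conjecture".
[cite: Baker2004, §3 (pp. 257–258)] [cite: LaishramShorey2012, Theorem 1] -/
theorem BakerExplicitABC.forall_exists_const (h : BakerExplicitABC) :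
    ∀ ε : ℝ, 0 < ε → ∃ C : ℝ, 0 < C ∧
      ∀ a b c : ℕ, IsABCTriple a b c → (c : ℝ) < C * ((rad a b c : ℕ) : ℝ) ^ (1 + ε) := by
  intro ε hε
  obtain ⟨C, hC1, hC⟩ := exists_const_log_pow_div_factorial_le ε hε
  refine ⟨6 / 5 * C, by positivity, fun a b c ht => ?_⟩
  have key : ∀ a b c : ℕ, IsABCTriple a b c → a < b →
      (c : ℝ) < 6 / 5 * C * ((rad a b c : ℕ) : ℝ) ^ (1 + ε) := by
    intro a b c ht hab
    have hB : (c : ℝ) < 6 / 5 * (rad a b c : ℝ) *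
        (Real.log (rad a b c : ℕ) ^ ω (a * b * c) / (ω (a * b * c))!) := by
      have := h a b c ht hab; rwa [mul_div_assoc] at this
    have hr1 : (1 : ℝ) ≤ (rad a b c : ℝ) := by
      exact_mod_cast le_trans (by norm_num) ht.two_le_rad
    have hr0 : (0 : ℝ) < (rad a b c : ℝ) := by linarith
    have hfac : (((ω (a * b * c))! : ℕ) : ℝ) ≤ (rad a b c : ℝ) := by
      have h1 := factorial_cardDistinctFactors_le_radical (a * b * c)
      rw [← rad_def] at h1
      exact_mod_cast h1
    have hle := hC (ω (a * b * c)) (rad a b c : ℝ) hr1 hfac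
    calc (c : ℝ) < 6 / 5 * (rad a b c : ℝ) *
          (Real.log (rad a b c : ℕ) ^ ω (a * b * c) / (ω (a * b * c))!) := hB
      _ ≤ 6 / 5 * (rad a b c : ℝ) * (C * (rad a b c : ℝ) ^ ε) := by gcongr
      _ = 6 / 5 * C * ((rad a b c : ℝ) ^ (1 : ℝ) * (rad a b c : ℝ) ^ ε) := by
          rw [Real.rpow_one]; ring
      _ = 6 / 5 * C * (rad a b c : ℝ) ^ (1 + ε) := by rw [← Real.rpow_add hr0]
  rcases lt_trichotomy a b with hab | hab | hab
  · exact key a b c ht hab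
  · obtain ⟨rfl, rfl, rfl⟩ := ht.eq_one_of_eq hab
    rw [rad_one_one_two]
    push_cast
    have h2 : (2 : ℝ) ≤ (2 : ℝ) ^ (1 + ε) := by
      calc (2 : ℝ) = 2 ^ (1 : ℝ) := (Real.rpow_one 2).symm
        _ ≤ 2 ^ (1 + ε) := Real.rpow_le_rpow_of_exponent_le (by norm_num) (by linarith)
    nlinarith
  · have := key b a c ht.symm hab
    rwa [rad_swap'] at this

/-- **Baker's Conjecture 4 implies the abc conjecture** (quality form `ABCQualityForm`, abc.S05 = the
Masser–Oesterlé conjecture, Bombieri–Gubler Rem. 12.4.15): in particular `BakerExplicitABC` is at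
least as hard as `ABC`, and no `BakerExplicitABC_holds` can be expected. [cite: Baker2004, §3 (pp. 257–258)] -/
theorem BakerExplicitABC.abcQualityForm (h : BakerExplicitABC) : ABCQualityForm :=
  abcQualityForm_of_forall_exists_const h.forall_exists_const

/-- Equivalently, Conjecture 4 refutes the abc-neg flag `ABCNegation` (abc.S02). [cite: Baker2004, §3 (pp. 257–258)] -/
theorem BakerExplicitABC.not_abcNegation (h : BakerExplicitABC) : ¬ ABCNegation :=
  abcQualityForm_iff_not_abcNegation.mp h.abcQualityForm

/-! ### The normalisation `a < b` in abc.S04 is necessary (appended by the second provefact seat) -/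

/-- Over *all* abc triples — dropping the binder `a < b` of `BakerExplicitABC` — Baker's
displayed inequality is FALSE: at `1 + 1 = 2` one has `N = rad(1·1·2) = 2`, `ω = 1` and
`(6/5) · 2 · log 2 = 1.66… < 2` (`Real.log_two_lt_d9`). Baker's wording ("integers with no
common factor", `a + b + c = 0`) and Laishram–Shorey's Conjecture 1.2 ("pairwise coprime positive
integers") formally admit this triple, while Waldschmidt's abc-triples (`0 < a < b`, Conjecture 15)
and Baker's data (Nitaj's tables, `a < b < c`) exclude it; this witness is why abc.S04 carries
`a < b`, which discards exactly `1 + 1 = 2` and the swapped copies (`IsABCTriple.eq_one_of_eq`).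
[cite: Baker2004, §3 Conjecture 4 (p. 257)] -/
theorem not_bakerExplicitBound_all_triples :
    ¬ ∀ a b c : ℕ, IsABCTriple a b c →
      (c : ℝ) < 6 / 5 * (rad a b c : ℝ) *
        Real.log (rad a b c : ℕ) ^ (ArithmeticFunction.cardDistinctFactors (a * b * c)) /
        (Nat.factorial (ArithmeticFunction.cardDistinctFactors (a * b * c)) : ℝ) := by
  intro H
  have h := H 1 1 2 ⟨one_pos, one_pos, rfl, Nat.coprime_one_left 1⟩
  have hω : ArithmeticFunction.cardDistinctFactors (1 * 1 * 2) = 1 := by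
    rw [show (1 * 1 * 2 : ℕ) = 2 from rfl]
    exact ArithmeticFunction.cardDistinctFactors_apply_prime Nat.prime_two
  rw [rad_one_one_two, hω] at h
  simp only [Nat.factorial_one, Nat.cast_one, div_one, pow_one, Nat.cast_ofNat] at h
  have h2 := Real.log_two_lt_d9
  linarith

/-- Hence `BakerExplicitABC` is *equivalent* to its restriction-free reading with the single triple
`1 + 1 = 2` excepted: for `b < a` the inequality follows by symmetry (`rad` and `ω(abc)` are
symmetric in `a, b`), and `a = b` forces `(a, b, c) = (1, 1, 2)`.
[cite: Baker2004, §3 Conjecture 4 (p. 257)] -/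
theorem bakerExplicitABC_iff_ne_one_one_two :
    BakerExplicitABC ↔ ∀ a b c : ℕ, IsABCTriple a b c → (a, b, c) ≠ (1, 1, 2) →
      (c : ℝ) < 6 / 5 * (rad a b c : ℝ) *
        Real.log (rad a b c : ℕ) ^ (ArithmeticFunction.cardDistinctFactors (a * b * c)) /
        (Nat.factorial (ArithmeticFunction.cardDistinctFactors (a * b * c)) : ℝ) := by
  constructor
  · intro H a b c ht hne
    rcases lt_trichotomy a b with hab | hab | hab
    · exact H a b c ht hab
    · obtain ⟨rfl, rfl, rfl⟩ := ht.eq_one_of_eq hab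
      exact absurd rfl hne
    · have h' := H b a c ht.symm hab
      rwa [rad_swap', mul_comm b a] at h'
  · intro H a b c ht hab
    refine H a b c ht ?_
    rintro ⟨rfl, rfl, rfl⟩
    exact lt_irrefl 1 hab

end Literature.NumberTheory.DiophantineGeometry

end
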